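import Summits.KontsevichZagierPeriods.KontsevichZagierPeriods.Theses.IsogenyCertificates
import Summits.KontsevichZagierPeriods.KontsevichZagierPeriods.Theorems.EffectiveXMapChains.Negative.Mechanism
import Summits.KontsevichZagierPeriods.KontsevichZagierPeriods.Theorems.HermiteRigidityGenusTwoCycleTransferPushforwardDimOne
import Literature.NumberTheory.Transcendental.SemialgebraicMapsProofs

/-!
# `EffectiveXMapChains` (stmt-KontsevichZagierPeriods-10664, route IsogenyCertificates) — line
`full-component-sheets`, stub `stub_pieceCoV`

One piece, one move of rule (2) of the Kontsevich–Zagier calculus. For an x-rational isogeny datum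
`(f, g, c)` between `y² = P(x) = x³ + Ax + B` and `y² = P'(x) = x³ + A'x + B'` (Wronskian
`W = f'g − fg' ≠ 0` in `ℚ[X]` and certificate identity `c²·g·(f³ + A'fg² + B'g³) = P·W²`), the
x-map `R = f/g` has derivative `R' = W/g²`, and on the sheet set `S = {P > 0, g ≠ 0, W ≠ 0}` the
rule-2 integrand identity `a/√P = ((a/|c|)/√(P'∘R))·|R'|` holds (`cov_integrand_identity`). Hence on
a piece `K = connectedComponentIn S t` on which `R` is injective, the representations `[K, a/√P]`
and `[R(K), (a/|c|)/√P']` (integrands prescribed on the domains only) differ by ONE instance of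
`KZ.changeOfVariablesRel`, along `Φ(x) = R(x 0)`, `Φ' x = (R'(x 0)) • id` (`det = R'(x 0)`), `Φ`
being the `ℚ`-semialgebraic map `f/g` read in the coordinate `x 0` of `ℝ¹`. This is the registered
stub `stub_pieceCoV` of the line's skeleton; the proof adapts
`XMapPeriodTransferCells.stub_cellMove` (cell locus `{P > 0, W ≠ 0}`, conclusion in
`KZ.relations`) to the sheet set `S` and to the sharper conclusion `∈ KZ.changeOfVariablesRel`.
No definitions are introduced.

References: M. Kontsevich, D. Zagier, *Periods* (2001), §1.2 rule (2); L. C. Washington,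
*Elliptic Curves: Number Theory and Cryptography* (2008), §2.9.
-/

noncomputable section

open Polynomial Set MeasureTheory
open Literature.NumberTheory.Transcendental Literature.ModelTheory.ExponentialFields
open Summit.KontsevichZagierPeriods.IsogenyCertificates.EffectiveXMapChainsNegative
open Summit.KontsevichZagierPeriods.HermiteRigidity.GenusTwoCycleTransfer
  (det_smul_id_fin_one hasFDerivAt_fin_one)

namespace Summit.KontsevichZagierPeriods.IsogenyCertificates.EffectiveXMapChainsLine

/-- **Stub (one rule-2 move per piece).** On a piece (connected component of the sheet set through
`t`) where the x-map `R = f/g` is injective, `[piece, a/√P] − [R(piece), (a/|c|)/√P']` is ONE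
change-of-variables instance: `R` is `ℚ`-semialgebraic (rational), differentiable with
`R' = W/g²`, and `a/√P = (a/|c|)/√(P'∘R) · |R'|` is the datum identity read pointwise
(`cov_integrand_identity`). [cite: KontsevichZagier2001, §1.2 rule (2)] -/
theorem stub_pieceCoV (A B A' B' : ℤ) (f g : ℚ[X]) (c : ℚ) (hW : derivative f * g - f * derivative g ≠ 0) (hI : C (c ^ 2) * g * (f ^ 3 + C (A' : ℚ) * f * g ^ 2 + C (B' : ℚ) * g ^ 3) = (X ^ 3 + C (A : ℚ) * X + C (B : ℚ)) * (derivative f * g - f * derivative g) ^ 2) (t : ℝ) (hinj : Set.InjOn (fun x : ℝ => aeval x f / aeval x g) (connectedComponentIn {x : ℝ | 0 < x ^ 3 + (A : ℝ) * x + (B : ℝ) ∧ aeval x g ≠ 0 ∧ aeval x (derivative f * g - f * derivative g) ≠ 0} t)) (a : ℚ) (ρ q : KZ.IntegralRep 1) (hρd : ρ.domain = {x : Fin 1 → ℝ | x 0 ∈ connectedComponentIn {x : ℝ | 0 < x ^ 3 + (A : ℝ) * x + (B : ℝ) ∧ aeval x g ≠ 0 ∧ aeval x (derivative f * g - f * derivative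 g) ≠ 0} t}) (hρi : Set.EqOn ρ.integrand (fun x => (a : ℝ) / Real.sqrt (x 0 ^ 3 + (A : ℝ) * x 0 + (B : ℝ))) ρ.domain) (hqd : q.domain = {y : Fin 1 → ℝ | y 0 ∈ (fun x : ℝ => aeval x f / aeval x g) '' connectedComponentIn {x : ℝ | 0 < x ^ 3 + (A : ℝ) * x + (B : ℝ) ∧ aeval x g ≠ 0 ∧ aeval x (derivative f * g - f * derivative g) ≠ 0} t}) (hqi : Set.EqOn q.integrand (fun y => ((a / |c| : ℚ) : ℝ) / Real.sqrt (y 0 ^ 3 + (A' : ℝ) * y 0 + (B' : ℝ))) q.domain) : KZ.of ρ - KZ.of q ∈ KZ.changeOfVariablesRel := by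
  -- the sheet set `S = {P > 0, g ≠ 0, W ≠ 0}`; the piece is `connectedComponentIn S t ⊆ S`
  set S : Set ℝ := {x : ℝ | 0 < x ^ 3 + (A : ℝ) * x + (B : ℝ) ∧ aeval x g ≠ 0 ∧
    aeval x (derivative f * g - f * derivative g) ≠ 0}
  have hcell : ∀ x ∈ ρ.domain, x 0 ∈ connectedComponentIn S t := fun x hx => by
    rwa [hρd] at hx
  have hdom : ∀ x ∈ ρ.domain, 0 < x 0 ^ 3 + (A : ℝ) * x 0 + (B : ℝ) ∧ aeval (x 0) g ≠ 0 ∧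
      aeval (x 0) (derivative f * g - f * derivative g) ≠ 0 := fun x hx =>
    connectedComponentIn_subset S t (hcell x hx)
  -- the image of the piece is the target domain
  have htdom : q.domain =
      (fun (x : Fin 1 → ℝ) (_ : Fin 1) => aeval (x 0) f / aeval (x 0) g) '' ρ.domain := by
    rw [hqd, hρd]
    ext y
    simp only [mem_image, mem_setOf_eq]
    constructor
    · rintro ⟨z, hz, hzy⟩
      refine ⟨fun _ => z, hz, ?_⟩
      funext i
      rw [Fin.fin_one_eq_zero i]
      exact hzy
    · rintro ⟨p, hp, rfl⟩
      exact ⟨p 0, hp, rfl⟩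
  refine ⟨1, ρ, q, fun x _ => aeval (x 0) f / aeval (x 0) g,
    fun x => (aeval (x 0) (derivative f * g - f * derivative g) / aeval (x 0) g ^ 2) •
      ContinuousLinearMap.id ℝ (Fin 1 → ℝ), ?_, ?_, ?_, htdom, ?_, rfl⟩
  · -- `Φ` is a `ℚ`-semialgebraic map on the piece: it is `f/g` in the coordinate `x 0`
    refine IsSemialgebraicMapOn.of_forall ρ.isSemialgebraic_domain fun _ => ?_
    have h := isSemialgebraicFunOn_aeval_div_aeval ρ.isSemialgebraic_domain
      (aeval (MvPolynomial.X 0 : MvPolynomial (Fin 1) ℚ) f)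
      (aeval (MvPolynomial.X 0 : MvPolynomial (Fin 1) ℚ) g)
      (fun x hx => by rw [← aeval_algHom_apply, MvPolynomial.aeval_X]; exact (hdom x hx).2.1)
    refine h.congr fun x _ => ?_
    beta_reduce
    rw [← aeval_algHom_apply, MvPolynomial.aeval_X, ← aeval_algHom_apply, MvPolynomial.aeval_X]
  · -- derivative `Φ' x = R'(x 0) • id`, `R' = W/g²` (quotient rule)
    intro x hx
    have hd : HasDerivAt (fun y : ℝ => aeval y f / aeval y g)
        (aeval (x 0) (derivative f * g - f * derivative g) / aeval (x 0) g ^ 2) (x 0) := by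
      refine ((Polynomial.hasDerivAt_aeval f (x 0)).fun_div
        (Polynomial.hasDerivAt_aeval g (x 0)) (hdom x hx).2.1).congr_deriv ?_
      simp only [map_sub, map_mul]
    exact (hasFDerivAt_fin_one _ _ x hd).hasFDerivWithinAt
  · -- injectivity on the piece (hypothesis)
    intro p hp p' hp' h
    have h' : aeval (p 0) f / aeval (p 0) g = aeval (p' 0) f / aeval (p' 0) g := congrFun h 0
    have hpq : p 0 = p' 0 := hinj (hcell p hp) (hcell p' hp') h'
    funext i
    rw [Fin.fin_one_eq_zero i]
    exact hpq
  · -- the Jacobian identity (`cov_integrand_identity`)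
    intro x hx
    have hmem : (fun _ : Fin 1 => aeval (x 0) f / aeval (x 0) g) ∈ q.domain :=
      htdom ▸ mem_image_of_mem _ hx
    obtain ⟨hP, hGx, hWx⟩ := hdom x hx
    rw [hρi hx, hqi hmem, det_smul_id_fin_one]
    simp only [Rat.cast_div, Rat.cast_abs]
    exact cov_integrand_identity hW hI hP hGx hWx (a : ℝ)

end Summit.KontsevichZagierPeriods.IsogenyCertificates.EffectiveXMapChainsLine

end
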